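/-
Copyright (c) 2026 the pub-hodgecm-mathlib formalisation cell (harness21).  Prover seat hodgecm-mathlib-K2E3-p20 (g4), HCML Track B «K2-LIT» (build stream 29),
h413 = `stmt-HodgeConjecture-24833`, line `K2_E3_EllipticInputs`, unit U12 «Characters», socket #11 road (11-SC), letter (SC-an), END-GAME MAP v1 brick [M5](D1-split)
(K2E3-p20 (g3) `K2/STATUS.md` 2026-09-04T02:22:50Z; K2E3-p21 (g3) YIELD 02:34:15Z): HARISH-CHANDRA'S THEOREM 14 FOR THE SPLIT CARTAN OF `U(σ, Φ₃)(K)` —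
the normalised orbital integral of a bounded compactly supported function over `U ⧸ T`, `T` the diagonal torus, is bounded by the module of the regular twist.  2026-09-04.
-/
import Literature.NumberTheory.Automorphic.TorusOrbitalDescentTwist              -- ★ FILE A (L8b generic): `exists_lintegral_descConj_eq_mul_lintegral_prod_torus_mul_unipotent` (`∫_{G⧸T} F(yty⁻¹) = C·J·∫_{K×N} F(k (t n) k⁻¹)`)
import Literature.NumberTheory.Automorphic.ArchU21SplitIwasawa                  -- ★ ring-generic §1–§2: `HeisRing.isInvInvariant_of_isHaarMeasure_unipotentU` (`N₃(R)` unimodular), `exists_homeomorph_torusU_prod_unipotentU_three_eq_anMap` (`T × N ≃ₜ B`); brings ★ `LineRing.forall_mem_torusU_comm` ∕ `conj_mem_unipotentU_of_mem_torusU` ∕ `isClosed_unipotentU`, ★ `isClosed_torusU_of_t1Space`, ★ `isInvInvariant_of_isMulRightInvariant`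
import Literature.NumberTheory.Automorphic.UnitaryGroupHeisenbergRingRegularTwist -- ★ LEMMA 22 ring-generic: `HeisRing.lintegral_conj_eq_mul_lintegral_mul` (`∫_N F(u t u⁻¹) = (‖a−1‖·χ⁻(b−1))⁻¹ ∫_N F(t u)`), `HeisRing.map_unit_torusCentralScalar_sub_one`
import Literature.MeasureTheory.Group.InvariantQuotientAbelian                    -- ★ `isInvInvariant_of_comm` (`T` abelian ⇒ its Haar measures are inversion invariant)
import HarnessLib

/-!
# h413 ∕ Track B «K2-LIT», (SC-an) line, brick [M5](D1-split): HARISH-CHANDRA'S THEOREM 14 ON THE SPLIT TORUS OF `U(σ, Φ₃)(K)` —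
# `∫_{U ⧸ T} Θ(ẏ t ẏ⁻¹) dμ_{U⧸T} ≤ C · ‖Θ‖_∞ · |det(Ad t − 1)_𝔫|⁻¹` for EVERY regular diagonal `t`, one `C = C(μ_{U⧸T}, K₁, supp Θ)`
# (Harish-Chandra 1970, Part VI §8 Theorem 14 p. 60 — the split Cartan; Part VII §3 p. 72; Part V §2 Lemma 22)

Cell `pub/hodgecm-mathlib`, crux H413 = `stmt-HodgeConjecture-24833`, route of record `HCCMUnconditional`; chair K2-lead (g0), dealer K2E3-plan (g2), (SC-an) line lead K2E3-p14 (g3)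
(D28); this brick = item [M5](D1-split) of the END-GAME MAP v1 (K2E3-p20 (g3), `K2/STATUS.md` 2026-09-04T02:22:50Z: «`|D(t)|^{1∕2} ∫_{G∕T} |θ(x t x⁻¹)| ≤ C_θ` on `T'` =
TORUS DESCENT ★ (L8b) + ★ Lemma 22»), taken under K2E3-p21 (g3)'s file name after their YIELD 02:34:15Z.  THEOREMS ONLY (no `def`, no `instance`, no `notation`, no
named-fact hypothesis, no `sorry`); lane `--supports stmt-HodgeConjecture-24833 --as helper`, count-neutral.

THE PRINT.  [HarishChandra1970, Part VI §8 Theorem 14 p. 60]: «Let `A` be a torus, `ω_A` compact in `A`, `h ∈ C_c^∞(G)`.  Then `sup_{a ∈ ω_A′} |F_h(a)| < ∞`» with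
`F_h(a) = |D(a)|^{1∕2} ∫_{G∕A} h(a^x) dx*` — used on p. 72 (Part VII §3) as «`|Θ_T(γ^y)| ≤ ∫_{G∕A}|θ(γ^x)| dx̄ · ∫_A Φ_γ(x a y₀⁻¹) da ≤ c₄ |D(γ)|^{−1∕2} (1 + |λ(γ)|)^{4ℓ}`».
For the SPLIT Cartan `T = {diag(d)}` of the quasi-split `U(2,1) = U(σ, Φ₃)(K)` (rank one, `ℓ = 1`) the proof is the one of [Rogawski1990, Lemma 4.13.1 (a) p. 64, p. 70]:
(i) TORUS DESCENT in Iwasawa coordinates `U = K₁·T·N` [Gelbart1975, Thm. 9.22 (iii)] — `∫_{U⧸T} Θ(ẏ t ẏ⁻¹) dμ = C ∫_{K₁} ∫_N Θ(k n t n⁻¹ k⁻¹) dn dk` (★ FILE A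
`TorusOrbitalDescentTwist`); (ii) the REGULAR TWIST `n ↦ n t n⁻¹ = t·ψ_t(n)` of the Heisenberg radical [HarishChandra1970, Part V §2 Lemma 22 p. 42] —
`∫_N Θ(k n t n⁻¹ k⁻¹) dn = J(t) ∫_N Θ(k t n k⁻¹) dn`, `J(t) = |det(Ad t − 1)_𝔫|_F⁻¹ = (‖a − 1‖_K · χ⁻(b − 1))⁻¹`, `a = d₀⁻¹d₁`, `b = d₀⁻¹d₂` (★ ring-generic
`HeisRing.lintegral_conj_eq_mul_lintegral_mul`); (iii) the FIBRE BOUND, UNIFORM IN `t`: `Θ(k t n k⁻¹) ≠ 0 ⇒ t n ∈ K₁⁻¹·supp Θ·K₁ ∩ B`, and `B = T × N` topologically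
(★ `HeisRing.borelRingHomeomorph`), so `n` ranges in the compact projection `N_S ⊆ N` of `K₁⁻¹ S K₁ ∩ B`, INDEPENDENT of `t` (K2E3-p21 (g3)'s census note), whence
`∫_{K₁×N} Θ(k t n k⁻¹) ≤ ‖Θ‖_∞ · κ(K₁) · μ_N(N_S)`.  Altogether **`∫_{U⧸T} Θ(ẏ t ẏ⁻¹) dμ_{U⧸T} ≤ C·‖Θ‖_∞·J(t)`** for EVERY regular diagonal `t` — with
`J(t) = |D_G(t)|_F^{−1∕2}·δ_B(t)^{−1∕2}` (`δ_B(diag d) = ‖d₀⁻¹d₁‖_K²`), Theorem 14's «`ω_A` compact» being only the passage `J ≤ c_ω |D|^{−1∕2}` on `ω_A`.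

CURRENCY = the (SC-an) model currency of ★ [M4] p856742 `K2E3SupercuspidalTruncatedCharThm20` ∕ ★ (D2) p856791 `K2E3ConjugatorHeightControlRankOne` ∕ (D31) [M5-slice]
`K2E3TruncatedCharTorusSlicing` (K2E5-p01 (g4), whose head's right-hand factor `∫⁻ q, descConj t (torusU σ J) ht Θ q ∂μQ` is EXACTLY what is bounded here):
`U = ↥(unitaryGroupOfForm σ J)` over an abstract locally compact second countable Hausdorff topological field `K` with a continuous involution `σ` and `2 ≠ 0`,
`hJ : J = (StdForm.antidiagonal 3).over K`, `T = torusU σ J`, `N = unipotentU σ J`, `B = borelU σ J`; the quotient `↥U ⧸ torusU σ J` with a CONSUMER-SUPPLIED Borel structure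
(instance binders `[MeasurableSpace (↥U ⧸ torusU σ J)] [BorelSpace …]`, as ★ FILE A ∕ ★ (L8b) FILE B) and ANY `U`-invariant measure `μQ` finite on compacta;
the orbital integrand ★ `descConj t (torusU σ J) ht Θ` (`descConj_mk`: `= Θ(y t y⁻¹)`).  EVERY structural hypothesis of ★ FILE A is discharged ring-generically (★
`ArchU21SplitIwasawa` §1–§2, ★ `isClosed_torusU_of_t1Space`, ★ `isClosed_borelU`, ★ `LineRing.*`, ★ `isInvInvariant_of_comm`) EXCEPT two binders that are theorems only at a
place `K = L_w` and stay HYPOTHESES here: `hKB` — the Iwasawa decomposition `U = K₁·B` for a compact subgroup `K₁` (at `L_w`: ★ `exists_mem_cmLocalIntegralLevel_mul_borel` along ★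
`localNonsplitEquiv`) — and `hunimod` — every Haar measure of `U` is right invariant (at `L_w`: ★ [M2a] `K2E3SupercuspModelFrameAtPlace.isMulRightInvariant_of_isHaarMeasure_of_eq_over`).

* §1 GENERIC FIBRE BOUND (any topological group `G`, subgroups `T, N ≤ B` with `B` closed and `e : T × N ≃ₜ B` over `(t, n) ↦ t n`, a compact subgroup `K₁`, a compact `S`):
  **`exists_isCompact_lintegral_prod_conj_le`** — a compact `N_S ⊆ N` with `∫⁻_{K₁×N} Θ(k (t n) k⁻¹) d(κ ⊗ μ_N) ≤ M · κ(univ) · μ_N(N_S)` for EVERY `t ∈ T` and every `Θ ≤ M`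
  vanishing off `S`.
* §2 THE HEAD **`exists_const_lintegral_descConj_torusU_le`** — `∃ C : ℝ≥0, ∀ Θ` (measurable, `= 0` off `S`, `≤ M`), `∀ t = diag d ∈ T` regular (`d₀⁻¹d₁ − 1`, `d₀⁻¹d₂ − 1` units),
  `∫⁻ q, descConj t (torusU σ J) ht Θ q ∂μQ ≤ C * M * ↑((‖a−1‖_K)⁻¹ * (χ⁻(b−1))⁻¹)` — Lemma 22's module in its ★ tokens `distribHaarChar K ha.unit`, `HeisRing.skewModulus σ hσc hb.unit _`.
* §3 **`exists_const_lintegral_descConj_torusU_enorm_le`** — the same for `Θ = ‖θ‖ₑ`, `θ : U → ℂ` continuous with compact support (the supercuspidal coefficient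
  `θ = B v₁ (ρ(·) v₁)` of the line: ★ `IsSupercuspidal.hasCompactSupport_sesqForm_apply_apply`), `C = C(μQ, K₁, θ)`.

HONEST LABEL.  HC_CM is proved only modulo the 7 printed citations (2 remaining named inputs: hLiu418 = `stmt-HodgeConjecture-24832`, h413 = `stmt-HodgeConjecture-24833`)
until rung 0 closes; count-neutral helper (an intermediate of the (SC-dom) half of (SC-an); nothing printed is asserted as a fact).

## References
* [HarishChandra1970] Harish-Chandra (notes by G. van Dijk), *Harmonic Analysis on Reductive p-adic Groups*, LNM 162 (1970), Part V §2 Lemma 22 p. 42; Part VI §8 Theorem 14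
  p. 60; Part VII §3 pp. 71–73.
* [Rogawski1990] J. D. Rogawski, *Automorphic Representations of Unitary Groups in Three Variables*, Ann. of Math. Stud. 123 (1990), §1.10 p. 9; §4.9 (4.9.1)–(4.9.2) p. 55;
  §4.13 Lemma 4.13.1 (a) p. 64 and p. 70; §7.3 p. 97.
* [Gelbart1975] S. Gelbart, *Automorphic Forms on Adele Groups*, Ann. of Math. Stud. 83 (1975), Thm. 9.22 (iii), Remark 9.23.
* [GetzHahn2024] J. R. Getz, H. Hahn, *An Introduction to Automorphic Representations*, GTM 300 (2024), §3.5 (3.10).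
-/

set_option autoImplicit false
set_option linter.dupNamespace false  -- the mandated namespace repeats the single-problem summit's segment (`HodgeConjecture.HodgeConjecture`)

noncomputable section

open MeasureTheory Measure Set Filter Topology
open scoped ENNReal NNReal Pointwise Matrix MatrixGroups
open Literature.MeasureTheory.Group
open Literature.NumberTheory.Automorphic Literature.NumberTheory.Automorphic.UnitaryGroup Literature.NumberTheory.Rogawski1990

namespace Summit.HodgeConjecture.HodgeConjecture.Cruxes.H413.K2E3SplitTorusOrbitalBoundRankOne

/-! ## §1 Generic: the fibre bound, uniform in the torus element -/

section Fibre

variable {G : Type*} [Group G] [TopologicalSpace G] [IsTopologicalGroup G] [T2Space G] {K₁ T N B : Subgroup G}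

/-- **THE FIBRE BOUND, UNIFORM IN `t`** [HarishChandra1970, Part VII §3 p. 72; Part VI §8 Thm 14].  Let `T, N ≤ B ≤ G` with `B` closed and `(t, n) ↦ t n` a homeomorphism
`e : T × N ≃ₜ B` (★ `anMap` currency), `K₁ ≤ G` a compact subgroup with a finite measure `κ`, `μ_N` a measure on `N` finite on compacta, `S ⊆ G` compact.  There is a COMPACT
`N_S ⊆ N` — the `N`-projection of `K₁⁻¹·S·K₁ ∩ B`, INDEPENDENT of `t` — such that for every `t ∈ T`, every bound `M` and every `Θ : G → [0, ∞]` vanishing off `S` with `Θ ≤ M`: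
`∫⁻_{K₁ × N} Θ(k (t n) k⁻¹) d(κ ⊗ μ_N) ≤ M · κ(K₁) · μ_N(N_S)` (if `Θ(k t n k⁻¹) ≠ 0` then `t n = k⁻¹ s k ∈ B`, and `e⁻¹(t n) = (t, n)` puts `n` in `N_S`).
[cite: HarishChandra1970, Part VI §8 Theorem 14 p. 60; Part VII §3 p. 72] [cite: Rogawski1990, §4.13 p. 70] -/
theorem exists_isCompact_lintegral_prod_conj_le (hB : IsClosed (B : Set G)) (hTB : T ≤ B) (hNB : N ≤ B)
    (e : ↥T × ↥N ≃ₜ ↥B) (he : ∀ p, e p = anMap T N B hTB hNB p)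
    (hK₁ : IsCompact (K₁ : Set G)) {S : Set G} (hS : IsCompact S)
    [MeasurableSpace ↥K₁] (κ : Measure ↥K₁) [MeasurableSpace ↥N] [BorelSpace ↥N] (μN : Measure ↥N) [SFinite μN] :
    ∃ NS : Set ↥N, IsCompact NS ∧ ∀ (t : ↥T) (M : ℝ≥0∞) (Θ : G → ℝ≥0∞), (∀ g, Θ g ≠ 0 → g ∈ S) → (∀ g, Θ g ≤ M) →
      ∫⁻ p : ↥K₁ × ↥N, Θ ((p.1 : G) * ((t : G) * (p.2 : G)) * (p.1 : G)⁻¹) ∂(κ.prod μN) ≤ M * (κ univ * μN NS) := by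
  -- the compact `S₁ = K₁⁻¹ S K₁ ⊆ G`, its trace `S_B` on the closed `B`, and the `N`-projection `N_S` of `e⁻¹(S_B)`
  set S₁ : Set G := (fun p : G × G => p.1⁻¹ * p.2 * p.1) '' ((K₁ : Set G) ×ˢ S) with hS₁
  have hS₁c : IsCompact S₁ := (hK₁.prod hS).image ((continuous_fst.inv.mul continuous_snd).mul continuous_fst)
  set SB : Set ↥B := ((↑) : ↥B → G) ⁻¹' S₁ with hSB
  have hSBc : IsCompact SB := hB.isClosedEmbedding_subtypeVal.isCompact_preimage hS₁c
  set NS : Set ↥N := Prod.snd '' (e.symm '' SB) with hNS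
  have hNSc : IsCompact NS := (hSBc.image e.symm.continuous).image continuous_snd
  refine ⟨NS, hNSc, fun t M Θ hΘS hΘM => ?_⟩
  have hNSm : MeasurableSet NS := hNSc.isClosed.measurableSet
  -- pointwise: `Θ(k (t n) k⁻¹) ≤ M · 1_{K₁ × N_S}(k, n)`
  have hpt : ∀ p : ↥K₁ × ↥N, Θ ((p.1 : G) * ((t : G) * (p.2 : G)) * (p.1 : G)⁻¹) ≤ ((univ : Set ↥K₁) ×ˢ NS).indicator (fun _ => M) p := by
    intro p
    by_cases h0 : Θ ((p.1 : G) * ((t : G) * (p.2 : G)) * (p.1 : G)⁻¹) = 0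
    · rw [h0]; exact bot_le
    have hmem : (p.1 : G) * ((t : G) * (p.2 : G)) * (p.1 : G)⁻¹ ∈ S := hΘS _ h0
    -- `t n ∈ S₁ ∩ B`
    have htn : (t : G) * (p.2 : G) ∈ S₁ := by
      refine ⟨((p.1 : G), (p.1 : G) * ((t : G) * (p.2 : G)) * (p.1 : G)⁻¹), ⟨p.1.2, hmem⟩, ?_⟩
      simp only
      group
    set b : ↥B := ⟨(t : G) * (p.2 : G), B.mul_mem (hTB t.2) (hNB p.2.2)⟩ with hb
    have hbS : b ∈ SB := htn
    -- `e (t, n) = t n`, so `n = (e⁻¹ b).2 ∈ N_S`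
    have heb : e (t, p.2) = b := Subtype.ext (by rw [he, coe_anMap])
    have hn : p.2 ∈ NS := ⟨(t, p.2), ⟨b, hbS, by rw [← heb, Homeomorph.symm_apply_apply]⟩, rfl⟩
    rw [indicator_of_mem (mk_mem_prod (mem_univ _) hn)]
    exact hΘM _
  calc ∫⁻ p : ↥K₁ × ↥N, Θ ((p.1 : G) * ((t : G) * (p.2 : G)) * (p.1 : G)⁻¹) ∂(κ.prod μN)
      ≤ ∫⁻ p : ↥K₁ × ↥N, ((univ : Set ↥K₁) ×ˢ NS).indicator (fun _ => M) p ∂(κ.prod μN) := lintegral_mono hpt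
    _ = M * (κ.prod μN) ((univ : Set ↥K₁) ×ˢ NS) := lintegral_indicator_const (MeasurableSet.univ.prod hNSm) M
    _ = M * (κ univ * μN NS) := by rw [Measure.prod_prod]

end Fibre

/-! ## §2 The head: Theorem 14 on the split torus of `U(σ, Φ₃)(K)` -/

section Model

variable {K : Type*} [Field K] [TopologicalSpace K] [IsTopologicalRing K] [LocallyCompactSpace K] [T2Space K] [SecondCountableTopology K]
  [MeasurableSpace K] [BorelSpace K]
  (σ : K →+* K) (hσ : ∀ x, σ (σ x) = x) (hσc : Continuous σ) (h2 : (2 : K) ≠ 0)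
  {J : Matrix (Fin 3) (Fin 3) K} (hJ : J = (StdForm.antidiagonal 3).over K)
  [MeasurableSpace ↥(unitaryGroupOfForm σ J)] [BorelSpace ↥(unitaryGroupOfForm σ J)]
  [SecondCountableTopology ↥(unitaryGroupOfForm σ J)] [LocallyCompactSpace ↥(unitaryGroupOfForm σ J)]

include hσ h2 hJ in
/-- **HARISH-CHANDRA'S THEOREM 14 ON THE SPLIT TORUS OF `U(σ, Φ₃)(K)`** — the normalised orbital integral over `U ⧸ T` of a bounded function with compact support is
bounded by the module of the regular twist, UNIFORMLY over the regular diagonal elements.  Let `K₁ ≤ U` be a compact subgroup with `U = K₁·B` (`hKB`, Iwasawa), let every Haar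
measure of `U` be right invariant (`hunimod`), let `μQ` be ANY `U`-invariant measure on `↥U ⧸ T`, finite on compacta, and `S ⊆ U` compact.  Then there is ONE `C : ℝ≥0` such that
for every measurable `Θ : U → [0,∞]` vanishing off `S` and bounded by `M`, and every `t = diag(d) ∈ T` with `a − 1 = d₀⁻¹d₁ − 1` and `b − 1 = d₀⁻¹d₂ − 1` units (i.e. `t` regular):
`∫⁻_{U⧸T} Θ(ẏ t ẏ⁻¹) dμQ ≤ C · M · (‖a−1‖_K · χ⁻(b−1))⁻¹` — print's `|D(t)|^{1∕2} ∫_{G∕A} |θ(t^x)| dx* ≤ C_θ`, since `(‖a−1‖·χ⁻(b−1))⁻¹ = |D_G(t)|_F^{−1∕2} δ_B(t)^{−1∕2}`.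
Proof: ★ FILE A torus descent (all structural hypotheses discharged ring-generically) ∘ ★ Lemma 22 (`hJac`) ∘ §1.
[cite: HarishChandra1970, Part VI §8 Theorem 14 p. 60; Part VII §3 p. 72; Part V §2 Lemma 22 p. 42] [cite: Rogawski1990, §4.13 Lemma 4.13.1 (a) p. 64, p. 70; §7.3 p. 97]
[cite: Gelbart1975, Thm. 9.22 (iii)] -/
theorem exists_const_lintegral_descConj_torusU_le
    (hunimod : ∀ ν : Measure ↥(unitaryGroupOfForm σ J), ν.IsHaarMeasure → ν.IsMulRightInvariant)
    {K₁ : Subgroup ↥(unitaryGroupOfForm σ J)} (hK₁ : IsCompact (K₁ : Set ↥(unitaryGroupOfForm σ J)))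
    (hKB : ∀ g : ↥(unitaryGroupOfForm σ J), ∃ k ∈ K₁, ∃ b ∈ borelU σ J, g = k * b)
    [MeasurableSpace (↥(unitaryGroupOfForm σ J) ⧸ torusU σ J)] [BorelSpace (↥(unitaryGroupOfForm σ J) ⧸ torusU σ J)]
    (μQ : Measure (↥(unitaryGroupOfForm σ J) ⧸ torusU σ J))
    [SMulInvariantMeasure ↥(unitaryGroupOfForm σ J) (↥(unitaryGroupOfForm σ J) ⧸ torusU σ J) μQ] [IsFiniteMeasureOnCompacts μQ]
    {S : Set ↥(unitaryGroupOfForm σ J)} (hS : IsCompact S) :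
    ∃ C : ℝ≥0, ∀ (Θ : ↥(unitaryGroupOfForm σ J) → ℝ≥0∞), Measurable Θ → (∀ g, Θ g ≠ 0 → g ∈ S) → ∀ (M : ℝ≥0∞), (∀ g, Θ g ≤ M) →
      ∀ (t : ↥(torusU σ J)) (ht : ∀ a ∈ torusU σ J, a * (t : ↥(unitaryGroupOfForm σ J)) = (t : ↥(unitaryGroupOfForm σ J)) * a)
        (d : Fin 3 → Kˣ) (hd : glDiagonal 3 K d = ((t : ↥(unitaryGroupOfForm σ J)) : GL (Fin 3) K))
        (ha : IsUnit ((((d 0)⁻¹ * d 1 : Kˣ) : K) - 1)) (hb : IsUnit ((((d 0)⁻¹ * d 2 : Kˣ) : K) - 1)),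
        ∫⁻ q, descConj (t : ↥(unitaryGroupOfForm σ J)) (torusU σ J) ht Θ q ∂μQ ≤
          C * M * (((distribHaarChar K ha.unit)⁻¹ *
            (HeisRing.skewModulus σ hσc hb.unit (HeisRing.map_unit_torusCentralScalar_sub_one σ hJ t hd hb))⁻¹ : ℝ≥0) : ℝ≥0∞) := by
  -- the degenerate case `μQ = 0`
  by_cases hμ : μQ = 0
  · refine ⟨0, fun Θ _ _ M _ t ht d hd ha hb => ?_⟩
    rw [hμ, lintegral_zero_measure]
    exact bot_le
  -- closed subgroups, their local compactness ∕ second countability, the Haar measures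
  have hT : IsClosed (torusU σ J : Set ↥(unitaryGroupOfForm σ J)) := isClosed_torusU_of_t1Space _ _
  have hN : IsClosed (unipotentU σ J : Set ↥(unitaryGroupOfForm σ J)) := LineRing.isClosed_unipotentU _ _
  have hB : IsClosed (borelU σ J : Set ↥(unitaryGroupOfForm σ J)) := isClosed_borelU _ _
  haveI : LocallyCompactSpace ↥(torusU σ J) := hT.isClosedEmbedding_subtypeVal.locallyCompactSpace
  haveI : LocallyCompactSpace ↥(unipotentU σ J) := hN.isClosedEmbedding_subtypeVal.locallyCompactSpace
  haveI : LocallyCompactSpace ↥K₁ := hK₁.isClosed.isClosedEmbedding_subtypeVal.locallyCompactSpace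
  haveI : SecondCountableTopology ↥(torusU σ J) := TopologicalSpace.Subtype.secondCountableTopology _
  haveI : SecondCountableTopology ↥(unipotentU σ J) := TopologicalSpace.Subtype.secondCountableTopology _
  haveI : SecondCountableTopology ↥K₁ := TopologicalSpace.Subtype.secondCountableTopology _
  haveI : CompactSpace ↥K₁ := isCompact_iff_compactSpace.1 hK₁
  haveI : Invertible (2 : K) := invertibleOfNonzero h2
  set κ : Measure ↥K₁ := Measure.haar with hκ
  set α : Measure ↥(torusU σ J) := Measure.haar with hα
  set μN : Measure ↥(unipotentU σ J) := Measure.haar with hμN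
  set ν : Measure ↥(unitaryGroupOfForm σ J) := Measure.haar with hν
  haveI : α.IsInvInvariant :=
    Literature.MeasureTheory.Group.isInvInvariant_of_comm _ hT (fun x hx y hy => LineRing.forall_mem_torusU_comm σ J hy x hx) α
  haveI : μN.IsInvInvariant := HeisRing.isInvInvariant_of_isHaarMeasure_unipotentU σ hσ hσc hJ μN
  haveI : ν.IsMulRightInvariant := hunimod ν inferInstance
  haveI : ν.IsInvInvariant := isInvInvariant_of_isMulRightInvariant ν
  -- `T × N ≃ₜ B` and the torus descent (★ FILE A) with one constant `C₀`
  obtain ⟨e, he⟩ := exists_homeomorph_torusU_prod_unipotentU_three_eq_anMap σ hJ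
  obtain ⟨C₀, -, hdesc⟩ := exists_lintegral_descConj_eq_mul_lintegral_prod_torus_mul_unipotent hK₁ hT hB (torusU_le_borelU _ _)
    (unipotentU_le_borelU _ _) (fun a ha n hn => LineRing.conj_mem_unipotentU_of_mem_torusU σ J ha hn) e he hKB ν κ α μN μQ hμ
  -- the `t`-uniform fibre bound (§1)
  obtain ⟨NS, hNSc, hfib⟩ := exists_isCompact_lintegral_prod_conj_le hB (torusU_le_borelU _ _) (unipotentU_le_borelU _ _) e he hK₁ hS κ μN
  have hκfin : κ univ < ∞ := IsCompact.measure_lt_top isCompact_univ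
  have hNSfin : μN NS < ∞ := hNSc.measure_lt_top
  refine ⟨C₀ * (κ univ * μN NS).toNNReal, fun Θ hΘm hΘS M hΘM t ht d hd ha hb => ?_⟩
  -- Lemma 22: the twist binder at the regular `t`
  have hJac : ∀ Φ : ↥(unitaryGroupOfForm σ J) → ℝ≥0∞, Measurable Φ →
      ∫⁻ n : ↥(unipotentU σ J), Φ ((n : ↥(unitaryGroupOfForm σ J)) * (t : ↥(unitaryGroupOfForm σ J)) * (n : ↥(unitaryGroupOfForm σ J))⁻¹) ∂μN =
        (((distribHaarChar K ha.unit)⁻¹ *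
            (HeisRing.skewModulus σ hσc hb.unit (HeisRing.map_unit_torusCentralScalar_sub_one σ hJ t hd hb))⁻¹ : ℝ≥0) : ℝ≥0∞) *
          ∫⁻ n : ↥(unipotentU σ J), Φ ((t : ↥(unitaryGroupOfForm σ J)) * (n : ↥(unitaryGroupOfForm σ J))) ∂μN :=
    fun Φ hΦ => HeisRing.lintegral_conj_eq_mul_lintegral_mul σ hσ hσc hJ μN t hd ha hb Φ hΦ
  rw [hdesc (t : ↥(unitaryGroupOfForm σ J)) ht hJac Θ hΘm]
  have hle := hfib t M Θ hΘS hΘM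
  have hprod : ((κ univ * μN NS).toNNReal : ℝ≥0∞) = κ univ * μN NS := ENNReal.coe_toNNReal (ENNReal.mul_ne_top hκfin.ne hNSfin.ne)
  calc (C₀ : ℝ≥0∞) * (((distribHaarChar K ha.unit)⁻¹ *
          (HeisRing.skewModulus σ hσc hb.unit (HeisRing.map_unit_torusCentralScalar_sub_one σ hJ t hd hb))⁻¹ : ℝ≥0) : ℝ≥0∞) *
        ∫⁻ p : ↥K₁ × ↥(unipotentU σ J), Θ ((p.1 : ↥(unitaryGroupOfForm σ J)) * ((t : ↥(unitaryGroupOfForm σ J)) * (p.2 : ↥(unitaryGroupOfForm σ J))) *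
          (p.1 : ↥(unitaryGroupOfForm σ J))⁻¹) ∂(κ.prod μN)
      ≤ (C₀ : ℝ≥0∞) * (((distribHaarChar K ha.unit)⁻¹ *
          (HeisRing.skewModulus σ hσc hb.unit (HeisRing.map_unit_torusCentralScalar_sub_one σ hJ t hd hb))⁻¹ : ℝ≥0) : ℝ≥0∞) *
        (M * (κ univ * μN NS)) := by gcongr
    _ = ((C₀ * (κ univ * μN NS).toNNReal : ℝ≥0) : ℝ≥0∞) * M * (((distribHaarChar K ha.unit)⁻¹ *
          (HeisRing.skewModulus σ hσc hb.unit (HeisRing.map_unit_torusCentralScalar_sub_one σ hJ t hd hb))⁻¹ : ℝ≥0) : ℝ≥0∞) := by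
        rw [show (((C₀ * (κ univ * μN NS).toNNReal : ℝ≥0)) : ℝ≥0∞) = (C₀ : ℝ≥0∞) * (κ univ * μN NS) by rw [ENNReal.coe_mul, hprod]]
        ring

/-! ## §3 The supercuspidal-coefficient shape: `Θ = ‖θ‖ₑ` for `θ` continuous with compact support -/

include hσ h2 hJ in
/-- **THEOREM 14 ON THE SPLIT TORUS FOR A CONTINUOUS COMPACTLY SUPPORTED `θ : U → ℂ`** (the supercuspidal coefficient `θ = B v₁ (ρ(·) v₁)` of the (SC-an) line): ONE
`C = C(μQ, K₁, θ) : ℝ≥0` with `∫⁻_{U⧸T} ‖θ(ẏ t ẏ⁻¹)‖ₑ dμQ ≤ C · (‖a−1‖_K · χ⁻(b−1))⁻¹` for EVERY regular diagonal `t = diag(d)` — the `∫_{G∕A}|θ(γ^x)|dx̄ ≤ c|D(γ)|^{−1∕2}`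
factor of the domination weight `W` of ★ `K2E3SupercuspidalTruncatedCharDominationOfBricks` (`hball`), up to `δ_B^{−1∕2}` (bounded on height balls).
[cite: HarishChandra1970, Part VI §8 Theorem 14 p. 60; Part VII §3 p. 72] [cite: Rogawski1990, §4.13 Lemma 4.13.1 (a) p. 64, p. 70] -/
theorem exists_const_lintegral_descConj_torusU_enorm_le
    (hunimod : ∀ ν : Measure ↥(unitaryGroupOfForm σ J), ν.IsHaarMeasure → ν.IsMulRightInvariant)
    {K₁ : Subgroup ↥(unitaryGroupOfForm σ J)} (hK₁ : IsCompact (K₁ : Set ↥(unitaryGroupOfForm σ J)))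
    (hKB : ∀ g : ↥(unitaryGroupOfForm σ J), ∃ k ∈ K₁, ∃ b ∈ borelU σ J, g = k * b)
    [MeasurableSpace (↥(unitaryGroupOfForm σ J) ⧸ torusU σ J)] [BorelSpace (↥(unitaryGroupOfForm σ J) ⧸ torusU σ J)]
    (μQ : Measure (↥(unitaryGroupOfForm σ J) ⧸ torusU σ J))
    [SMulInvariantMeasure ↥(unitaryGroupOfForm σ J) (↥(unitaryGroupOfForm σ J) ⧸ torusU σ J) μQ] [IsFiniteMeasureOnCompacts μQ]
    {θ : ↥(unitaryGroupOfForm σ J) → ℂ} (hθ : Continuous θ) (hθc : HasCompactSupport θ) :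
    ∃ C : ℝ≥0, ∀ (t : ↥(torusU σ J)) (ht : ∀ a ∈ torusU σ J, a * (t : ↥(unitaryGroupOfForm σ J)) = (t : ↥(unitaryGroupOfForm σ J)) * a)
        (d : Fin 3 → Kˣ) (hd : glDiagonal 3 K d = ((t : ↥(unitaryGroupOfForm σ J)) : GL (Fin 3) K))
        (ha : IsUnit ((((d 0)⁻¹ * d 1 : Kˣ) : K) - 1)) (hb : IsUnit ((((d 0)⁻¹ * d 2 : Kˣ) : K) - 1)),
        ∫⁻ q, descConj (t : ↥(unitaryGroupOfForm σ J)) (torusU σ J) ht (fun g => ‖θ g‖ₑ) q ∂μQ ≤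
          C * (((distribHaarChar K ha.unit)⁻¹ *
            (HeisRing.skewModulus σ hσc hb.unit (HeisRing.map_unit_torusCentralScalar_sub_one σ hJ t hd hb))⁻¹ : ℝ≥0) : ℝ≥0∞) := by
  obtain ⟨C, hC⟩ := exists_const_lintegral_descConj_torusU_le σ hσ hσc h2 hJ hunimod hK₁ hKB μQ hθc.isCompact
  -- a bound for `‖θ‖`
  obtain ⟨M, hM⟩ := (hθ.norm.bddAbove_range_of_hasCompactSupport hθc.norm)
  refine ⟨C * M.toNNReal, fun t ht d hd ha hb => ?_⟩
  have hmeas : Measurable fun g : ↥(unitaryGroupOfForm σ J) => ‖θ g‖ₑ := hθ.measurable.enorm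
  have hsupp : ∀ g : ↥(unitaryGroupOfForm σ J), ‖θ g‖ₑ ≠ 0 → g ∈ tsupport θ := fun g hg =>
    subset_tsupport θ (by simpa [Function.mem_support, enorm_eq_zero] using hg)
  have hbdd : ∀ g : ↥(unitaryGroupOfForm σ J), ‖θ g‖ₑ ≤ ((M.toNNReal : ℝ≥0) : ℝ≥0∞) := fun g =>
    calc ‖θ g‖ₑ = ENNReal.ofReal ‖θ g‖ := (ofReal_norm (θ g)).symm
      _ ≤ ENNReal.ofReal M := ENNReal.ofReal_le_ofReal (hM ⟨g, rfl⟩)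
      _ = ((M.toNNReal : ℝ≥0) : ℝ≥0∞) := rfl
  refine (hC _ hmeas hsupp _ hbdd t ht d hd ha hb).trans_eq ?_
  simp only [ENNReal.coe_mul]

end Model

end Summit.HodgeConjecture.HodgeConjecture.Cruxes.H413.K2E3SplitTorusOrbitalBoundRankOne

end
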